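import Summits.Ventures.HodgeKum4.Theorems.KummerFixedLocusL1HilbModelAux
import Summits.Ventures.HodgeKum4.Theorems.KummerFixedLocusL1HilbCert
import Summits.Ventures.HodgeKum4.Theorems.KummerFixedLocusL1HilbEvalAux
import Mathlib.Tactic.Module
import Literature.AlgebraicGeometry.Motives.AbelianVarietyCohomologyExteriorH1
import Literature.AlgebraicGeometry.Motives.AbelianVarietyProjectiveChart
import Literature.AlgebraicGeometry.Hyperkaehler.LLVStructureKummerType
import Literature.AlgebraicGeometry.HodgeTheory.TotalCohomologyKunneth
import Literature.AlgebraicGeometry.HilbertScheme.LefschetzDualHilbertScheme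
import Literature.AlgebraicGeometry.HilbertScheme.NakajimaOperators
import Literature.Algebra.Lie.Sl2PartnerUnique
import Mathlib.LinearAlgebra.Dimension.OrzechProperty
import Mathlib.LinearAlgebra.Matrix.ToLin
import HarnessLib

/-!
# Lane (V), line v2p5 — stub S-C (basis part): the basis `bvec f` of `H*(A(ℂ); ℂ)`, `α ⌣ α ≠ 0`, symplectic Gram–Schmidt

Cell `hodge-kum4`, crux stmt-Ventures-20141, registered stub `stub_model` of the v2p5 skeleton.  For an abelian surface
`A` (`H•(A(ℂ); ℂ) = Λ•H¹`, `dim H¹ = 4`, the tree's THEOREM `Motives.abelianVarietyCohomologyExteriorH1_holds`) and a class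
`α ∈ H²` with a dual Lefschetz operator `Λ_A`:
(1) for every basis `f` of `H¹` the `16` ordered products `bvec f I` (`…L1HilbModelAux`) form a basis `b` of `H*(A(ℂ); ℂ)`
in which left cup product by `b I` is the integer matrix `mulMat I` (structure constants `wsign`);
(2) `α ⌣ α ≠ 0` (the `𝔰𝔩₂`-relations at `1 ∈ H⁰`), so `α = Σ_{i<j} c_{ij} f_i f_j` has non-zero Pfaffian and a
symplectic basis `g` with `α = g₀g₁ + g₂g₃` exists (explicit Gram–Schmidt in dimension `4`);
(3) in the basis `b = bvec g`, `[L_α, lamMat] = h`, `[h, lamMat] = −2·lamMat` are integer-matrix identities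
(`decide`), so `toLin b b lamMat` is an `𝔰𝔩₂`-partner of `(L_α, h)` and equals `Λ_A` by uniqueness
(`Algebra.Lie.dualPartner_unique`).  Nothing here asserts L1-Hilb(n) / L1 / HC_Kum4Type / HC.
-/

noncomputable section

open DirectSum
open Literature.AlgebraicTopology.SingularHomology
open Literature.AlgebraicGeometry Literature.AlgebraicGeometry.Hyperkaehler Literature.AlgebraicGeometry.HilbertScheme
open Literature.AlgebraicGeometry.HodgeTheory (complexBetti)
open Literature.AlgebraicGeometry.Motives (AbelianVariety ComplexPoints SchemeOver IsSmoothProjective)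

namespace Summit.Ventures.HodgeKum4.L1Hilb

namespace Model

/-! ### (1) The basis `bvec f` of `H*(A(ℂ); ℂ)` and the cup-product matrices -/

section Basis

variable {A : AbelianVariety ℂ} (hA : A.dim = 2) (u : Module.Basis (Fin 4) ℂ (complexBetti A.X 1))

/-- `e_i = bvec (2^i)`. -/
theorem e_eq_bvec (f : Fin 4 → complexBetti A.X 1) (i : Fin 4) :
    e f i = bvec f (⟨2 ^ i.val, by have := i.isLt; interval_cases i.val <;> decide⟩ : Fin 16) := by
  obtain ⟨h1, h2, h4, h8⟩ := bvec_single f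
  fin_cases i
  · exact h1.symm
  · exact h2.symm
  · exact h4.symm
  · exact h8.symm

/-- The span of the `bvec u I` is closed under left cup product by the `e_i`. -/
theorem e_mul_mem_span (i : Fin 4) {x : totalCohomology ℂ (ComplexPoints A.X)}
    (hx : x ∈ Submodule.span ℂ (Set.range (bvec u))) :
    totalCup ℂ (ComplexPoints A.X) (e u i) x ∈ Submodule.span ℂ (Set.range (bvec u)) := by
  induction hx using Submodule.span_induction with
  | mem y hy =>
    obtain ⟨J, rfl⟩ := hy
    rw [e_eq_bvec, bvec_mul]
    exact Submodule.smul_mem _ _ (Submodule.subset_span ⟨_, rfl⟩)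
  | zero => rw [map_zero]; exact Submodule.zero_mem _
  | add y z _ _ hy hz => rw [map_add]; exact Submodule.add_mem _ hy hz
  | smul c y _ hy => rw [map_smul]; exact Submodule.smul_mem _ _ hy

/-- Every iterated product `v₀ ⌣ ⋯ ⌣ v_{d−1} ⌣ 1` of degree-one classes lies in the span of the `bvec u I`. -/
theorem cupPowOne_mem_span (d : ℕ) (v : Fin d → complexBetti A.X 1) :
    ofDegree ℂ (ComplexPoints A.X) d (cupPowOne ℂ (ComplexPoints A.X) d v) ∈ Submodule.span ℂ (Set.range (bvec u)) := by
  induction d with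
  | zero => exact Submodule.subset_span ⟨0, (bvec_zero u).trans (by rw [cupPowOne_zero])⟩
  | succ d ih =>
    rw [cupPowOne_succ, ← ofDegree_cupProduct_index rfl (Nat.add_comm 1 d), ← totalCup_lof]
    -- expand `v 0` in the basis `u`
    have hv : ∀ x : complexBetti A.X 1, ofDegree ℂ (ComplexPoints A.X) 1 x = ∑ i, u.repr x i • e u i := by
      intro x
      conv_lhs => rw [← u.sum_repr x]
      rw [map_sum]
      simp only [map_smul, e_def]
    rw [hv (v 0), map_sum, LinearMap.sum_apply]
    refine Submodule.sum_mem _ fun i _ ↦ ?_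
    rw [map_smul, LinearMap.smul_apply]
    exact Submodule.smul_mem _ _ (e_mul_mem_span u i (ih (Fin.tail v)))

/-- The `bvec u I` span `H*(A(ℂ); ℂ)`. -/
theorem span_bvec_eq_top : Submodule.span ℂ (Set.range (bvec u)) = ⊤ := by
  refine Submodule.eq_top_iff'.mpr fun x ↦ ?_
  induction x using DirectSum.induction_on with
  | zero => exact Submodule.zero_mem _
  | add x y hx hy => exact Submodule.add_mem _ hx hy
  | of d x =>
    rw [← lof_eq_of ℂ]
    have hx : x ∈ Submodule.span ℂ (Set.range (cupPowOne ℂ (ComplexPoints A.X) d)) := by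
      rw [Motives.abelianVarietyCohomologyExteriorH1_holds.span_range_cupPowOne A d]; exact Submodule.mem_top
    induction hx using Submodule.span_induction with
    | mem y hy =>
      obtain ⟨v, rfl⟩ := hy
      exact cupPowOne_mem_span u d v
    | zero => rw [map_zero]; exact Submodule.zero_mem _
    | add y z _ _ hy hz => rw [map_add]; exact Submodule.add_mem _ hy hz
    | smul c y _ hy => rw [map_smul]; exact Submodule.smul_mem _ _ hy

/-- `dim H*(A(ℂ); ℂ) = 16` for an abelian surface. -/
theorem finrank_total (hA : A.dim = 2) : Module.finrank ℂ (totalCohomology ℂ (ComplexPoints A.X)) = 16 := by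
  have hS : IsSmoothProjective 2 A.X := hA ▸ AbelianVariety.isSmoothProjective_holds
  rw [HodgeTheory.finrank_totalCohomology hS]
  simp only [Motives.abelianVarietyCohomologyExteriorH1_holds.finrank_eq, hA, Finset.sum_range_succ,
    Finset.sum_range_zero]
  decide

/-- **The basis `b = bvec u` of `H*(A(ℂ); ℂ)`** (abelian surface, `u` a basis of `H¹`). -/
def basisB (hA : A.dim = 2) : Module.Basis (Fin 16) ℂ (totalCohomology ℂ (ComplexPoints A.X)) :=
  haveI : Module.Finite ℂ (totalCohomology ℂ (ComplexPoints A.X)) :=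
    finite_totalCohomology (n := 2) (X := A.X) (hA ▸ AbelianVariety.isSmoothProjective_holds)
  basisOfTopLeSpanOfCardEqFinrank (bvec u) (span_bvec_eq_top u).ge
    (by rw [finrank_total hA, Fintype.card_fin])

/-- The basis vectors are the `bvec u I`. -/
theorem basisB_apply (I : Fin 16) : basisB u hA I = bvec u I := by
  rw [basisB, coe_basisOfTopLeSpanOfCardEqFinrank]

/-- **Left cup product by `b I` is the model matrix `mulMat I`.** -/
theorem toLin_mulMat (I : Fin 16) :
    Matrix.toLin (basisB u hA) (basisB u hA) ((mulMat I).map (Int.castRingHom ℂ)) =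
      totalCup ℂ (ComplexPoints A.X) (basisB u hA I) := by
  refine (basisB u hA).ext fun P ↦ ?_
  rw [Matrix.toLin_self, basisB_apply, basisB_apply, bvec_mul,
    Finset.sum_eq_single (bor I P) (fun Q _ hQ ↦ by simp [mulMat, hQ]) (by simp)]
  simp [mulMat, basisB_apply]

end Basis

/-! ### (2) Degree-one algebra, `α ⌣ α ≠ 0`, and the symplectic basis -/

section Symplectic

variable {A : AbelianVariety ℂ}

/-- `x ⌣ x = 0` for `x ∈ H¹`. -/
theorem sq_one (x : complexBetti A.X 1) :
    totalCup ℂ (ComplexPoints A.X) (ofDegree ℂ _ 1 x) (ofDegree ℂ _ 1 x) = 0 := by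
  rw [totalCup_lof, cup_self_deg_one, map_zero]

/-- `y ⌣ (x ⌣ v) = −x ⌣ (y ⌣ v)` for `x, y ∈ H¹`. -/
theorem one_one_swap (x y : complexBetti A.X 1) (v : totalCohomology ℂ (ComplexPoints A.X)) :
    totalCup ℂ _ (ofDegree ℂ _ 1 y) (totalCup ℂ _ (ofDegree ℂ _ 1 x) v) =
      -totalCup ℂ _ (ofDegree ℂ _ 1 x) (totalCup ℂ _ (ofDegree ℂ _ 1 y) v) := by
  have h := e_mul_e_mul (![x, y, x, y]) 0 1 v
  simpa [e_def] using h

/-- `y ⌣ x = −x ⌣ y` for `x, y ∈ H¹`. -/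
theorem one_one_comm (x y : complexBetti A.X 1) :
    totalCup ℂ _ (ofDegree ℂ _ 1 y) (ofDegree ℂ _ 1 x) = -totalCup ℂ _ (ofDegree ℂ _ 1 x) (ofDegree ℂ _ 1 y) := by
  have h := e_mul_comm (![x, y, x, y]) 1 0
  simpa [e_def] using h

/-- `(x ⌣ y) ⌣ (x ⌣ y) = 0` for `x, y ∈ H¹`. -/
theorem sq_one_one (x y : complexBetti A.X 1) :
    totalCup ℂ _ (totalCup ℂ _ (ofDegree ℂ _ 1 x) (ofDegree ℂ _ 1 y)) (totalCup ℂ _ (ofDegree ℂ _ 1 x) (ofDegree ℂ _ 1 y)) = 0 := by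
  rw [totalCup_assoc, one_one_swap x y, map_neg, ← totalCup_assoc, sq_one, map_zero, LinearMap.zero_apply, neg_zero]

/-- `1 ≠ 0` in `H⁰(A(ℂ); ℂ)` (`dim H⁰ = 1`). -/
theorem one_ne_zero_H0 : singularCohomology.one ℂ (ComplexPoints A.X) ≠ 0 := by
  intro h0
  haveI := Motives.abelianVarietyCohomologyExteriorH1_holds.finite A 0
  have hpos : 0 < Module.finrank ℂ (complexBetti A.X 0) := by
    rw [Motives.abelianVarietyCohomologyExteriorH1_holds.finrank_zero A]; exact one_pos
  obtain ⟨x, hx⟩ := Module.finrank_pos_iff_exists_ne_zero.mp hpos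
  apply hx
  have h1 := one_totalCup (R := ℂ) (ofDegree ℂ (ComplexPoints A.X) 0 x)
  rw [h0, map_zero, map_zero, LinearMap.zero_apply] at h1
  exact DirectSum.of_injective (β := fun k ↦ singularCohomology ℂ ℂ (ComplexPoints A.X) k) 0 (by
    rw [map_zero]; exact h1.symm)

/-- **`α ⌣ α ≠ 0`** for a class `α ∈ H²(A)` with a dual Lefschetz operator in "complex dimension" `2`: the
`𝔰𝔩₂`-relations at `1 ∈ H⁰` give `Λ α = 2·1` and `Λ(α²) = 2α`. -/
theorem sq_ne_zero (α : complexBetti A.X 2) (Λ : Module.End ℂ (totalCohomology ℂ (ComplexPoints A.X)))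
    (hΛ : IsDualLefschetz 2 α Λ) :
    totalCup ℂ _ (ofDegree ℂ (ComplexPoints A.X) 2 α) (ofDegree ℂ (ComplexPoints A.X) 2 α) ≠ 0 := by
  letI : LieRing (Module.End ℂ (totalCohomology ℂ (ComplexPoints A.X))) := LieRing.ofAssociativeRing
  set a := ofDegree ℂ (ComplexPoints A.X) 2 α with ha
  set v₁ := ofDegree ℂ (ComplexPoints A.X) 0 (singularCohomology.one ℂ (ComplexPoints A.X)) with hv₁
  have hL : totalLefschetz α = totalCup ℂ (ComplexPoints A.X) a := totalLefschetz_eq_totalCup α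
  have hLv : totalLefschetz α v₁ = a := by rw [hL, hv₁, totalCup_one]
  have hΛv : Λ v₁ = 0 := by
    have h := hΛ.isOfDegree 0 (singularCohomology.one ℂ (ComplexPoints A.X))
    unfold shiftedPart at h
    rw [if_neg (by norm_num)] at h
    exact (Submodule.mem_bot ℂ).mp h
  -- at `1`: `Λ a = 2 • 1`
  have h1 := LinearMap.congr_fun hΛ.lie_e_f v₁
  rw [Ring.lie_def, LinearMap.sub_apply, Module.End.mul_apply, Module.End.mul_apply, hΛv, map_zero, zero_sub, hLv, hv₁,
    degreeOperator_lof] at h1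
  -- at `a`: `a ⌣ Λ a − Λ (a ⌣ a) = 0`
  have h2 := LinearMap.congr_fun hΛ.lie_e_f a
  rw [Ring.lie_def, LinearMap.sub_apply, Module.End.mul_apply, Module.End.mul_apply, hL, ha, degreeOperator_lof,
    ← ha] at h2
  norm_num at h2
  intro hsq
  rw [hsq, map_zero, sub_zero] at h2
  -- `h2 : a ⌣ Λ a = 0`; with `h1 : -Λ a = (0 - 2) • 1`
  have hΛa : Λ a = (2 : ℂ) • v₁ := by
    have := neg_eq_iff_eq_neg.mp h1
    rw [this, hv₁]
    norm_num
  rw [hΛa, map_smul, hv₁, totalCup_one] at h2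
  have ha0 : a = 0 := by
    rcases smul_eq_zero.mp h2 with h | h
    · norm_num at h
    · exact h
  rw [ha0, map_zero] at hΛa
  have hv0 : v₁ = 0 := by
    have h3 := hΛa.symm
    rw [smul_eq_zero] at h3
    exact h3.resolve_left (by norm_num)
  exact one_ne_zero_H0 (A := A) (DirectSum.of_injective (β := fun k ↦ singularCohomology ℂ ℂ (ComplexPoints A.X) k) 0
    (by rw [map_zero]; exact hv0))

/-- The six degree-two basis vectors are the ordered products `e_i ⌣ e_j`. -/
theorem bvec_two (f : Fin 4 → complexBetti A.X 1) :
    bvec f 3 = totalCup ℂ _ (e f 0) (e f 1) ∧ bvec f 5 = totalCup ℂ _ (e f 0) (e f 2) ∧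
      bvec f 6 = totalCup ℂ _ (e f 1) (e f 2) ∧ bvec f 9 = totalCup ℂ _ (e f 0) (e f 3) ∧
      bvec f 10 = totalCup ℂ _ (e f 1) (e f 3) ∧ bvec f 12 = totalCup ℂ _ (e f 2) (e f 3) := by
  refine ⟨?_, ?_, ?_, ?_, ?_, ?_⟩
  · show prodList f (bitsList 3) = _
    rw [show bitsList 3 = [0, 1] from by decide, prodList_cons, prodList_cons, prodList_nil, totalCup_one]
  · show prodList f (bitsList 5) = _
    rw [show bitsList 5 = [0, 2] from by decide, prodList_cons, prodList_cons, prodList_nil, totalCup_one]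
  · show prodList f (bitsList 6) = _
    rw [show bitsList 6 = [1, 2] from by decide, prodList_cons, prodList_cons, prodList_nil, totalCup_one]
  · show prodList f (bitsList 9) = _
    rw [show bitsList 9 = [0, 3] from by decide, prodList_cons, prodList_cons, prodList_nil, totalCup_one]
  · show prodList f (bitsList 10) = _
    rw [show bitsList 10 = [1, 3] from by decide, prodList_cons, prodList_cons, prodList_nil, totalCup_one]
  · show prodList f (bitsList 12) = _
    rw [show bitsList 12 = [2, 3] from by decide, prodList_cons, prodList_cons, prodList_nil, totalCup_one]

variable (hA : A.dim = 2)

/-- **Every class of `H²` is a combination of the six ordered products `u_i ⌣ u_j`, `i < j`.** -/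
theorem exists_coeffs (hA : A.dim = 2) (u : Module.Basis (Fin 4) ℂ (complexBetti A.X 1)) (α : complexBetti A.X 2) :
    ∃ c : Fin 16 → ℂ, ofDegree ℂ (ComplexPoints A.X) 2 α =
      c 3 • totalCup ℂ _ (e u 0) (e u 1) + c 5 • totalCup ℂ _ (e u 0) (e u 2) + c 6 • totalCup ℂ _ (e u 1) (e u 2) +
      c 9 • totalCup ℂ _ (e u 0) (e u 3) + c 10 • totalCup ℂ _ (e u 1) (e u 3) + c 12 • totalCup ℂ _ (e u 2) (e u 3) := by
  set b := basisB u hA with hb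
  set r : Fin 16 → ℂ := fun I ↦ b.repr (ofDegree ℂ (ComplexPoints A.X) 2 α) I with hr
  refine ⟨r, ?_⟩
  have hhom : ∀ I, b I ∈ LinearMap.range (ofDegree ℂ (ComplexPoints A.X) (deg4 I)) := fun I ↦ by
    rw [hb, basisB_apply]; exact bvec_mem_range u I
  have hexp : ∑ I, r I • b I = ofDegree ℂ (ComplexPoints A.X) 2 α := b.sum_repr (ofDegree ℂ (ComplexPoints A.X) 2 α)
  have hzero : ∀ I : Fin 16, deg4 I ≠ 2 → r I = 0 := fun I hI ↦ Eval.repr_eq_zero_of_deg_ne hhom 2 α I hI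
  have hT : ∑ I, r I • b I = ∑ I ∈ ({3, 5, 6, 9, 10, 12} : Finset (Fin 16)), r I • b I := by
    refine (Finset.sum_subset (Finset.subset_univ _) fun I _ hI ↦ ?_).symm
    have hdeg : ∀ J : Fin 16, J ∉ ({3, 5, 6, 9, 10, 12} : Finset (Fin 16)) → deg4 J ≠ 2 := by decide
    rw [hzero I (hdeg I hI), zero_smul]
  obtain ⟨h3, h5, h6, h9, h10, h12⟩ := bvec_two u
  rw [← hexp, hT, Finset.sum_insert (by decide), Finset.sum_insert (by decide), Finset.sum_insert (by decide),
    Finset.sum_insert (by decide), Finset.sum_insert (by decide), Finset.sum_singleton]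
  simp only [hb, basisB_apply, h3, h5, h6, h9, h10, h12]
  abel

/-- **Symplectic Gram–Schmidt in dimension `4`.**  If `a = Σ_{i<j} c_{ij} p_i ⌣ p_j` for a spanning family
`p₀, …, p₃` of `H¹` with `c₀₁ ≠ 0` and `a ⌣ a ≠ 0`, then `a = g₀g₁ + g₂g₃` for a basis `g` of `H¹`
(`g₀ = p₀ − (c₁₂/c₀₁)p₂ − (c₁₃/c₀₁)p₃`, `g₁ = c₀₁p₁ + c₀₂p₂ + c₀₃p₃`, `g₂ = κ p₂`, `g₃ = p₃`). -/
theorem gramSchmidt (hA : A.dim = 2) (p : Fin 4 → complexBetti A.X 1) (hp : ⊤ ≤ Submodule.span ℂ (Set.range p))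
    (c : Fin 16 → ℂ) (a : totalCohomology ℂ (ComplexPoints A.X))
    (ha : a = c 3 • totalCup ℂ _ (e p 0) (e p 1) + c 5 • totalCup ℂ _ (e p 0) (e p 2) + c 6 • totalCup ℂ _ (e p 1) (e p 2) +
      c 9 • totalCup ℂ _ (e p 0) (e p 3) + c 10 • totalCup ℂ _ (e p 1) (e p 3) + c 12 • totalCup ℂ _ (e p 2) (e p 3))
    (h01 : c 3 ≠ 0) (hsq : totalCup ℂ _ a a ≠ 0) :
    ∃ g : Module.Basis (Fin 4) ℂ (complexBetti A.X 1),
      a = totalCup ℂ _ (e g 0) (e g 1) + totalCup ℂ _ (e g 2) (e g 3) := by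
  set κ : ℂ := c 12 + (c 6 * c 9 - c 10 * c 5) / c 3 with hκ
  set g0 : complexBetti A.X 1 := p 0 - (c 6 / c 3) • p 2 - (c 10 / c 3) • p 3 with hg0
  set g1 : complexBetti A.X 1 := c 3 • p 1 + c 5 • p 2 + c 9 • p 3 with hg1
  -- the identity `a = g₀g₁ + κ p₂p₃`
  have hP21 := e_mul_comm p 2 1
  have hP31 := e_mul_comm p 3 1
  have hP32 := e_mul_comm p 3 2
  have hP22 := e_mul_self p 2
  have hP33 := e_mul_self p 3
  have hid : a = totalCup ℂ _ (ofDegree ℂ _ 1 g0) (ofDegree ℂ _ 1 g1) +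
      totalCup ℂ _ (ofDegree ℂ _ 1 (κ • p 2)) (ofDegree ℂ _ 1 (p 3)) := by
    rw [ha, hg0, hg1]
    simp only [map_add, map_sub, map_smul, LinearMap.sub_apply, LinearMap.smul_apply, ← e_def]
    rw [hP21, hP31, hP32, hP22, hP33]
    match_scalars <;> (try rw [hκ]) <;> (field_simp; try ring)
  -- `κ ≠ 0` from `a ⌣ a ≠ 0`
  have hκ0 : κ ≠ 0 := by
    intro h0
    apply hsq
    rw [hid, h0, zero_smul, map_zero, map_zero, LinearMap.zero_apply, add_zero, sq_one_one]
  -- the new family spans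
  set g' : Fin 4 → complexBetti A.X 1 := ![g0, g1, κ • p 2, p 3] with hg'
  have hsp : ⊤ ≤ Submodule.span ℂ (Set.range g') := by
    have hm : ∀ k, g' k ∈ Submodule.span ℂ (Set.range g') := fun k ↦ Submodule.subset_span ⟨k, rfl⟩
    have h3 : p 3 ∈ Submodule.span ℂ (Set.range g') := by simpa [hg'] using hm 3
    have h2 : p 2 ∈ Submodule.span ℂ (Set.range g') := by
      have := Submodule.smul_mem _ κ⁻¹ (hm 2)
      simpa [hg', smul_smul, inv_mul_cancel₀ hκ0] using this
    have h1 : p 1 ∈ Submodule.span ℂ (Set.range g') := by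
      have h : p 1 = (c 3)⁻¹ • (g1 - c 5 • p 2 - c 9 • p 3) := by
        rw [hg1]; match_scalars <;> (field_simp; try ring)
      rw [h]
      exact Submodule.smul_mem _ _ (Submodule.sub_mem _ (Submodule.sub_mem _ (by simpa [hg'] using hm 1)
        (Submodule.smul_mem _ _ h2)) (Submodule.smul_mem _ _ h3))
    have h0 : p 0 ∈ Submodule.span ℂ (Set.range g') := by
      have h : p 0 = g0 + (c 6 / c 3) • p 2 + (c 10 / c 3) • p 3 := by rw [hg0]; module
      rw [h]
      exact Submodule.add_mem _ (Submodule.add_mem _ (by simpa [hg'] using hm 0) (Submodule.smul_mem _ _ h2))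
        (Submodule.smul_mem _ _ h3)
    refine hp.trans (Submodule.span_le.mpr ?_)
    rintro _ ⟨k, rfl⟩
    fin_cases k
    · exact h0
    · exact h1
    · exact h2
    · exact h3
  haveI : Module.Finite ℂ (complexBetti A.X 1) := Motives.abelianVarietyCohomologyExteriorH1_holds.finite_one A
  have hcard : Fintype.card (Fin 4) = Module.finrank ℂ (complexBetti A.X 1) := by
    rw [Motives.abelianVarietyCohomologyExteriorH1_holds.finrank_one A, hA, Fintype.card_fin]
  refine ⟨basisOfTopLeSpanOfCardEqFinrank g' hsp hcard, ?_⟩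
  simp only [e_def, coe_basisOfTopLeSpanOfCardEqFinrank, hg']
  simpa using hid

end Symplectic

end Model

end Summit.Ventures.HodgeKum4.L1Hilb

end
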